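import Literature.MathematicalPhysics.QuantumFieldTheory.ConformalBootstrap3D.BlockExistenceAB
import Mathlib.Analysis.Normed.Group.Tannery
import Mathlib.Analysis.SpecialFunctions.Pow.Continuity
import Mathlib.Tactic
import HarnessLib

/-!
# The mixed-channel block at accidental degeneracies: the limit clause of `IsConformalBlock3D` for all external dimensions

Completion of `BlockExistenceAB`: for every `Δ₁₂, Δ₃₄` and every `Δ₀` STRICTLY above the 3D unitarity
bound — regular or an accidental degeneracy of the Casimir recursion — `hrBlockAB Δ₁₂ Δ₃₄ Δ₀ ℓ` satisfies
the genuine typed predicate `IsConformalBlock3D Δ₁₂ Δ₃₄ Δ₀ ℓ` (`isConformalBlock3D_hrBlockAB_of_lt`). At a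
regular point this is `BlockExistenceAB`; on the accidental-degeneracy set the predicate is the limit clause
(Kos–Poland–Simmons-Duffin 2014 §4), and the witnessing family is `Δ' ↦ hrBlockAB Δ₁₂ Δ₃₄ Δ' ℓ`: every
Dolan–Osborn coefficient `A_{n,j}(a,b;Δ)` is continuous in `Δ` above the bound (all descendant-range pivots
are positive there, `casimirPivot3D_pos`), the growth bound of `BlockExistenceAB` holds with ONE constant on
`[Δ₀, Δ₀+1]` (compactness), and Tannery's theorem gives right-continuity of the series and of the block in
`Δ`. Together with `BlockExistenceLimit` (equal external dimensions at the unitarity bound) this leaves, of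
all `(Δ, ℓ, Δ₁₂, Δ₃₄)` allowed by 3D unitarity, exactly the points `Δ = ℓ+1` (`ℓ ≥ 1`) with
`Δ₁₂ Δ₃₄ ≠ 0`, where the block has a genuine pole (`MixedBlockCoefficients.hrCoeffAB_one_pred`) and no
function satisfies the predicate — clause A2 then excludes spin-`ℓ` conserved currents from `σ × ε`, as the
Ward identity does (Kos–Poland–Simmons-Duffin 2014 §4, pole family 3). No new hypothesis-style fact.

Sources: F. A. Dolan, H. Osborn, Nucl. Phys. B 678 (2004) 491 [hep-th/0309180], §3 eqs. (3.9)–(3.12);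
F. Kos, D. Poland, D. Simmons-Duffin, JHEP 11 (2014) 109 [arXiv:1406.4858], §4 eqs. (4.2)–(4.3); the
continuity/dominated-convergence argument is ours (elementary). Mathlib: `tendsto_tsum_of_dominated_convergence`.
-/

namespace Literature.MathematicalPhysics.QuantumFieldTheory.ConformalBootstrap3D

open Finset Set Filter Topology

/-! ### 1. Continuity of the `(a,b)` coefficients in `Δ` above the unitarity bound -/

/-- Every Dolan–Osborn coefficient `A_{n,j}(a,b;Δ)` is continuous in `Δ` at a point strictly above the
unitarity bound (off the descendant range it is identically `0`; on it the pivot is positive).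
[cite: DolanOsborn2004, §3 eqs. (3.9)–(3.12)] -/
theorem continuousAt_hrCoeffAB (a b : ℝ) {Δ₀ : ℝ} {ℓ : ℕ} (hΔ₀ : unitarityBound3D ℓ < Δ₀) :
    ∀ n j : ℕ, ContinuousAt (fun Δ => hrCoeffAB a b Δ ℓ n j) Δ₀ := by
  intro n
  induction n with
  | zero =>
    intro j
    by_cases hj : j = ℓ
    · subst hj
      simp only [hrCoeffAB_zero_self]
      exact continuousAt_const
    · simp only [hrCoeffAB_zero_of_ne _ _ _ hj]
      exact continuousAt_const
  | succ n ih =>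
    intro j
    by_cases hr : InDescendantRange ℓ (n + 1) j
    · obtain ⟨hjl, hju, hpar⟩ := hr
      have hpiv : casimirPivot3D Δ₀ ℓ (n + 1) j ≠ 0 :=
        (casimirPivot3D_pos hΔ₀ (by omega) hjl hju hpar).ne'
      have hnum : ContinuousAt (fun Δ =>
          (if j = 0 then (0 : ℝ) else hrGammaPlusAB a b (Δ + n) (j - 1) * hrCoeffAB a b Δ ℓ n (j - 1)) +
            hrGammaMinusAB a b (Δ + n) (j + 1) * hrCoeffAB a b Δ ℓ n (j + 1)) Δ₀ := by
        refine ContinuousAt.add ?_ ?_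
        · split_ifs
          · exact continuousAt_const
          · refine ContinuousAt.mul ?_ (ih (j - 1))
            unfold hrGammaPlusAB
            exact (((((continuous_id.add continuous_const).add continuous_const).add
              continuous_const).mul (((continuous_id.add continuous_const).add continuous_const).add
              continuous_const)).mul continuous_const |>.div_const _).continuousAt
        · refine ContinuousAt.mul ?_ (ih (j + 1))
          unfold hrGammaMinusAB
          exact ((((((continuous_id.add continuous_const).sub continuous_const).sub
            continuous_const).add continuous_const).mul ((((continuous_id.add continuous_const).sub
            continuous_const).sub continuous_const).add continuous_const)).mul continuous_const
            |>.div_const _).continuousAt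
      have hden : ContinuousAt (fun Δ => casimirPivot3D Δ ℓ (n + 1) j) Δ₀ := by
        unfold casimirPivot3D
        exact (((continuous_const.mul continuous_id).add continuous_const).add continuous_const
          |>.sub continuous_const).continuousAt
      have key : (fun Δ => hrCoeffAB a b Δ ℓ (n + 1) j) = fun Δ =>
          ((if j = 0 then (0 : ℝ) else hrGammaPlusAB a b (Δ + n) (j - 1) * hrCoeffAB a b Δ ℓ n (j - 1)) +
            hrGammaMinusAB a b (Δ + n) (j + 1) * hrCoeffAB a b Δ ℓ n (j + 1)) /
            casimirPivot3D Δ ℓ (n + 1) j := by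
        funext Δ; rw [hrCoeffAB_succ]
      rw [key]
      exact hnum.div₀ hden hpiv
    · simp only [hrCoeffAB_eq_zero_of_not_inDescendantRange _ _ _ hr]
      exact continuousAt_const

/-- Continuity of the absolute level sums `Σ_j |A_{n,j}(a,b;Δ)|`. [cite: DolanOsborn2004, §3 eqs. (3.9)–(3.12)] -/
theorem continuousAt_hrAbsLevelSumAB (a b : ℝ) {Δ₀ : ℝ} {ℓ : ℕ} (hΔ₀ : unitarityBound3D ℓ < Δ₀)
    (n : ℕ) : ContinuousAt (fun Δ => hrAbsLevelSumAB a b Δ ℓ n) Δ₀ := by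
  unfold hrAbsLevelSumAB
  exact tendsto_finsetSum _ fun j _ => (continuousAt_hrCoeffAB a b hΔ₀ n j).abs

/-- Continuity of every double-series coefficient `k^{ab}_{mn}(Δ)`. [cite: DolanOsborn2004, §3 eqs. (3.10)–(3.11)] -/
theorem continuousAt_hrMonomialCoeffAB (a b : ℝ) {Δ₀ : ℝ} {ℓ : ℕ} (hΔ₀ : unitarityBound3D ℓ < Δ₀)
    (p : ℕ × ℕ) : ContinuousAt (fun Δ => hrMonomialCoeffAB a b Δ ℓ p) Δ₀ := by
  unfold hrMonomialCoeffAB hrSliceAB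
  split_ifs
  · exact tendsto_finsetSum _ fun j _ =>
      ((continuousAt_hrCoeffAB a b hΔ₀ _ j).div_const _).mul continuousAt_const
  · exact continuousAt_const

/-! ### 2. Uniform polynomial growth on `[Δ₀, Δ₀+1]` -/

/-- The growth mechanism of `BlockExistenceAB` with an externally supplied threshold, exponent and bound.
[cite: DolanOsborn2004, §3 eqs. (3.9)–(3.12)] -/
theorem hrAbsLevelSumAB_le_of_bound {a b c Δ : ℝ} {ℓ : ℕ} (hΔ : unitarityBound3D ℓ < Δ)
    (ha : |a| ≤ c) (hb : |b| ≤ c) {N₁ K : ℕ} (hN : abThreshold c Δ ℓ ≤ N₁)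
    (hK : 40 * c + 24 ≤ (K : ℝ)) {M : ℝ} (hM0 : 0 ≤ M)
    (hM : ∀ k : ℕ, k ≤ N₁ → hrAbsLevelSumAB a b Δ ℓ k ≤ M) (n : ℕ) :
    hrAbsLevelSumAB a b Δ ℓ n ≤ M * ascWeight K n := by
  have hthr : ∀ m : ℕ, N₁ ≤ m → abThreshold c Δ ℓ ≤ m := fun m hm => hN.trans (by exact_mod_cast hm)
  have hbase : ∀ k : ℕ, k ≤ N₁ → hrAbsLevelSumAB a b Δ ℓ k ≤ M * ascWeight K k := fun k hk =>
    calc hrAbsLevelSumAB a b Δ ℓ k ≤ M := hM k hk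
      _ = M * 1 := (mul_one M).symm
      _ ≤ M * ascWeight K k := mul_le_mul_of_nonneg_left (one_le_ascWeight K k) hM0
  have main : ∀ k : ℕ, hrAbsLevelSumAB a b Δ ℓ (N₁ + k) ≤ M * ascWeight K (N₁ + k) := by
    intro k
    induction k with
    | zero => exact hbase _ le_rfl
    | succ k ih =>
      have hq : 0 ≤ 1 + (K : ℝ) / (((N₁ + k : ℕ) : ℝ) + 1) := by positivity
      have hstep : 1 + (40 * c + 24) / (((N₁ + k : ℕ) : ℝ) + 1) ≤
          1 + (K : ℝ) / (((N₁ + k : ℕ) : ℝ) + 1) := by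
        have hpos : (0 : ℝ) < ((N₁ + k : ℕ) : ℝ) + 1 := by positivity
        have := div_le_div_of_nonneg_right hK hpos.le
        linarith
      calc hrAbsLevelSumAB a b Δ ℓ (N₁ + (k + 1)) = hrAbsLevelSumAB a b Δ ℓ (N₁ + k + 1) := by
            rw [Nat.add_assoc]
        _ ≤ (1 + (40 * c + 24) / (((N₁ + k : ℕ) : ℝ) + 1)) * hrAbsLevelSumAB a b Δ ℓ (N₁ + k) :=
            hrAbsLevelSumAB_succ_le hΔ ha hb (hthr _ (Nat.le_add_right _ _))
        _ ≤ (1 + (K : ℝ) / (((N₁ + k : ℕ) : ℝ) + 1)) * (M * ascWeight K (N₁ + k)) :=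
            mul_le_mul hstep ih (hrAbsLevelSumAB_nonneg a b Δ ℓ _) hq
        _ = M * ascWeight K (N₁ + k + 1) := by
            rw [← ascWeight_succ K (N₁ + k)]; push_cast; ring
        _ = M * ascWeight K (N₁ + (k + 1)) := by rw [Nat.add_assoc]
  rcases le_or_gt n N₁ with hn | hn
  · exact hbase n hn
  · obtain ⟨k, rfl⟩ := Nat.exists_eq_add_of_le hn.le
    exact main k

/-- **Uniform growth on `[Δ₀, Δ₀+1]`** for the `(a,b)` array: one exponent `K` and one constant `M ≥ 0`
with `Σ_j |A_{n,j}(a,b;Δ)| ≤ M q_K(n)` for all `n` and all `Δ ∈ [Δ₀, Δ₀+1]`, `Δ₀` strictly above the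
bound. [cite: DolanOsborn2004, §3 eqs. (3.9)–(3.12)] -/
theorem exists_uniform_absLevelSumAB_bound (a b : ℝ) {Δ₀ : ℝ} {ℓ : ℕ} (hΔ₀ : unitarityBound3D ℓ < Δ₀) :
    ∃ (K : ℕ) (M : ℝ), 0 ≤ M ∧ ∀ Δ : ℝ, Δ₀ ≤ Δ → Δ ≤ Δ₀ + 1 → ∀ n : ℕ,
      hrAbsLevelSumAB a b Δ ℓ n ≤ M * ascWeight K n := by
  set c := max |a| |b| with hc
  have ha : |a| ≤ c := le_max_left _ _
  have hb : |b| ≤ c := le_max_right _ _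
  have hc0 : 0 ≤ c := (abs_nonneg a).trans ha
  set κ := ⌈c⌉₊ with hκ
  set K : ℕ := 40 * κ + 24 with hK
  have hKc : 40 * c + 24 ≤ (K : ℝ) := by
    have : c ≤ (κ : ℝ) := Nat.le_ceil c
    rw [hK]; push_cast; linarith
  set N₁ := ⌈abThreshold c (Δ₀ + 1) ℓ⌉₊ with hN₁
  set F : ℝ → ℝ := fun Δ => ∑ k ∈ range (N₁ + 1), hrAbsLevelSumAB a b Δ ℓ k with hF
  have hcont : ContinuousOn F (Icc Δ₀ (Δ₀ + 1)) := by
    intro Δ hΔ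
    have hΔ' : unitarityBound3D ℓ < Δ := lt_of_lt_of_le hΔ₀ hΔ.1
    have hca : ContinuousAt F Δ := tendsto_finsetSum _ fun k _ => continuousAt_hrAbsLevelSumAB a b hΔ' k
    exact hca.continuousWithinAt
  obtain ⟨B, hB⟩ := isCompact_Icc.bddAbove_image hcont
  refine ⟨K, max B 0, le_max_right _ _, fun Δ hΔ0 hΔ1 n => ?_⟩
  have hΔ : unitarityBound3D ℓ < Δ := lt_of_lt_of_le hΔ₀ hΔ0
  have hhalf := one_half_lt_of_unitarityBound3D_lt hΔ
  have hFle : F Δ ≤ B := hB ⟨Δ, ⟨hΔ0, hΔ1⟩, rfl⟩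
  have hthrmono : abThreshold c Δ ℓ ≤ abThreshold c (Δ₀ + 1) ℓ := by
    unfold abThreshold hrThreshold
    have h1 : 0 ≤ Δ + (2 * c + 1) + ℓ + 2 := by positivity
    nlinarith
  have hN : abThreshold c Δ ℓ ≤ N₁ := hthrmono.trans (Nat.le_ceil _)
  refine hrAbsLevelSumAB_le_of_bound hΔ ha hb hN hKc (le_max_right _ _) (fun k hk => ?_) n
  calc hrAbsLevelSumAB a b Δ ℓ k ≤ F Δ :=
        Finset.single_le_sum (f := fun k => hrAbsLevelSumAB a b Δ ℓ k)
          (fun k _ => hrAbsLevelSumAB_nonneg a b Δ ℓ k) (mem_range.mpr (Nat.lt_succ_of_le hk))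
    _ ≤ B := hFle
    _ ≤ max B 0 := le_max_left _ _

/-! ### 3. Right-continuity in `Δ` and the genuine predicate above the bound -/

/-- The `(a,b)` series is right-continuous in `Δ` at every point strictly above the bound, for fixed
`z, z̄ ∈ (-1,1)` (Tannery). [cite: DolanOsborn2004, §3 eqs. (3.10)–(3.12)] -/
theorem tendsto_hrSeriesAB (a b : ℝ) {Δ₀ : ℝ} {ℓ : ℕ} (hΔ₀ : unitarityBound3D ℓ < Δ₀) {z zb : ℝ}
    (hz : |z| < 1) (hzb : |zb| < 1) :
    Tendsto (fun Δ => hrSeriesAB a b Δ ℓ z zb) (𝓝[>] Δ₀) (𝓝 (hrSeriesAB a b Δ₀ ℓ z zb)) := by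
  obtain ⟨K, M, hM0, hM⟩ := exists_uniform_absLevelSumAB_bound a b hΔ₀
  set t := max |z| |zb| with ht
  have ht0 : 0 ≤ t := le_max_of_le_left (abs_nonneg z)
  have ht1 : t < 1 := max_lt hz hzb
  have hlam := legendreLam_pos ℓ
  set bound : ℕ × ℕ → ℝ := fun p =>
    M / legendreLam ℓ * ((ascWeight K p.1 * t ^ p.1) * (ascWeight K p.2 * t ^ p.2)) with hbound
  have hg := summable_ascWeight_mul_pow K ht0 ht1
  have hsum : Summable bound :=
    (hg.mul_of_nonneg hg (fun m => mul_nonneg (ascWeight_pos K m).le (pow_nonneg ht0 _))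
      (fun m => mul_nonneg (ascWeight_pos K m).le (pow_nonneg ht0 _))).mul_left _
  unfold hrSeriesAB
  refine tendsto_tsum_of_dominated_convergence hsum (fun p => ?_) ?_
  · exact (((continuousAt_hrMonomialCoeffAB a b hΔ₀ p).mul continuousAt_const).mul
      continuousAt_const).tendsto.mono_left nhdsWithin_le_nhds
  · have hmem : Ioo Δ₀ (Δ₀ + 1) ∈ 𝓝[>] Δ₀ := Ioo_mem_nhdsGT (by linarith)
    filter_upwards [hmem] with Δ hΔ p
    have hk : |hrMonomialCoeffAB a b Δ ℓ p| ≤ M / legendreLam ℓ * (ascWeight K p.1 * ascWeight K p.2) := by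
      rcases Nat.lt_or_ge (p.1 + p.2) ℓ with hN | hN
      · rw [hrMonomialCoeffAB_eq_zero_of_lt a b Δ ℓ hN, abs_zero]
        exact mul_nonneg (div_nonneg hM0 hlam.le)
          (mul_nonneg (ascWeight_pos _ _).le (ascWeight_pos _ _).le)
      · refine (abs_hrMonomialCoeffAB_le a b Δ ℓ p hN).trans ?_
        have hle : hrAbsLevelSumAB a b Δ ℓ (p.1 + p.2 - ℓ) ≤ M * (ascWeight K p.1 * ascWeight K p.2) :=
          calc hrAbsLevelSumAB a b Δ ℓ (p.1 + p.2 - ℓ) ≤ M * ascWeight K (p.1 + p.2 - ℓ) :=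
                hM Δ hΔ.1.le hΔ.2.le _
            _ ≤ M * ascWeight K (p.1 + p.2) :=
                mul_le_mul_of_nonneg_left (ascWeight_mono K (by omega)) hM0
            _ ≤ M * (ascWeight K p.1 * ascWeight K p.2) :=
                mul_le_mul_of_nonneg_left (ascWeight_add_le K _ _) hM0
        calc hrAbsLevelSumAB a b Δ ℓ (p.1 + p.2 - ℓ) / legendreLam ℓ
            ≤ M * (ascWeight K p.1 * ascWeight K p.2) / legendreLam ℓ :=
              div_le_div_of_nonneg_right hle hlam.le
          _ = M / legendreLam ℓ * (ascWeight K p.1 * ascWeight K p.2) := by ring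
    have hq : 0 ≤ M / legendreLam ℓ * (ascWeight K p.1 * ascWeight K p.2) :=
      mul_nonneg (div_nonneg hM0 hlam.le) (mul_nonneg (ascWeight_pos _ _).le (ascWeight_pos _ _).le)
    have hzp : |z| ^ p.1 ≤ t ^ p.1 := pow_le_pow_left₀ (abs_nonneg z) (le_max_left _ _) _
    have hzbp : |zb| ^ p.2 ≤ t ^ p.2 := pow_le_pow_left₀ (abs_nonneg zb) (le_max_right _ _) _
    rw [Real.norm_eq_abs, abs_mul, abs_mul, abs_pow, abs_pow]
    calc |hrMonomialCoeffAB a b Δ ℓ p| * |z| ^ p.1 * |zb| ^ p.2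
        ≤ (M / legendreLam ℓ * (ascWeight K p.1 * ascWeight K p.2)) * t ^ p.1 * t ^ p.2 :=
          mul_le_mul (mul_le_mul hk hzp (pow_nonneg (abs_nonneg _) _) hq) hzbp
            (pow_nonneg (abs_nonneg _) _) (mul_nonneg hq (pow_nonneg ht0 _))
      _ = bound p := by rw [hbound]; ring

/-- The mixed block is right-continuous in `Δ` above the bound, pointwise on the open square.
[cite: DolanOsborn2004, §3 eqs. (3.10)–(3.12)] -/
theorem tendsto_hrBlockAB (Δ₁₂ Δ₃₄ : ℝ) {Δ₀ : ℝ} {ℓ : ℕ} (hΔ₀ : unitarityBound3D ℓ < Δ₀) {z zb : ℝ}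
    (hz : z ∈ Ioo (0 : ℝ) 1) (hzb : zb ∈ Ioo (0 : ℝ) 1) :
    Tendsto (fun Δ => hrBlockAB Δ₁₂ Δ₃₄ Δ ℓ z zb) (𝓝[>] Δ₀) (𝓝 (hrBlockAB Δ₁₂ Δ₃₄ Δ₀ ℓ z zb)) := by
  unfold hrBlockAB
  have hzabs : |z| < 1 := by rw [abs_of_pos hz.1]; exact hz.2
  have hzbabs : |zb| < 1 := by rw [abs_of_pos hzb.1]; exact hzb.2
  have hpow : Tendsto (fun Δ : ℝ => (z * zb) ^ ((Δ - (ℓ : ℝ)) / 2)) (𝓝[>] Δ₀)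
      (𝓝 ((z * zb) ^ ((Δ₀ - (ℓ : ℝ)) / 2))) := by
    have hc : Continuous fun Δ : ℝ => (z * zb) ^ ((Δ - (ℓ : ℝ)) / 2) :=
      (Real.continuous_const_rpow (mul_pos hz.1 hzb.1).ne').comp
        ((continuous_id.sub continuous_const).div_const _)
    exact hc.continuousAt.tendsto.mono_left nhdsWithin_le_nhds
  exact hpow.mul (tendsto_hrSeriesAB _ _ hΔ₀ hzabs hzbabs)

/-- **The genuine predicate at every point strictly above the bound, all external dimensions** —
regular points by `BlockExistenceAB`, accidental degeneracies by the limit clause.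
[cite: KosPolandSimmonsduffin2014, §4 eqs. (4.2)–(4.3)] -/
theorem isConformalBlock3D_hrBlockAB_of_lt (Δ₁₂ Δ₃₄ : ℝ) {Δ₀ : ℝ} {ℓ : ℕ}
    (hΔ₀ : unitarityBound3D ℓ < Δ₀) :
    IsConformalBlock3D Δ₁₂ Δ₃₄ Δ₀ ℓ (hrBlockAB Δ₁₂ Δ₃₄ Δ₀ ℓ) := by
  by_cases hreg : IsRegularPoint3D Δ₀ ℓ
  · exact Or.inl ⟨hreg, isConformalBlock3DAbove_hrBlockAB hΔ₀⟩
  · refine Or.inr ⟨hreg, fun Δ' => hrBlockAB Δ₁₂ Δ₃₄ Δ' ℓ, fun Δ' hΔ' => ?_, fun z zb hz hzb => ?_⟩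
    · exact isConformalBlock3DAbove_hrBlockAB (hΔ₀.trans hΔ'.1)
    · exact tendsto_hrBlockAB Δ₁₂ Δ₃₄ hΔ₀ hz hzb

/-- **Satisfiability of A2 above the bound, all channels**: for every `Δ₁₂, Δ₃₄` and every `(Δ, ℓ)` with
`Δ > unitarityBound3D ℓ` the typed block predicate has a solution.
[cite: KosPolandSimmonsduffin2014, §4 eqs. (4.2)–(4.3)] -/
theorem exists_isConformalBlock3D_of_lt (Δ₁₂ Δ₃₄ : ℝ) {Δ₀ : ℝ} {ℓ : ℕ}
    (hΔ₀ : unitarityBound3D ℓ < Δ₀) : ∃ g : ℝ → ℝ → ℝ, IsConformalBlock3D Δ₁₂ Δ₃₄ Δ₀ ℓ g :=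
  ⟨hrBlockAB Δ₁₂ Δ₃₄ Δ₀ ℓ, isConformalBlock3D_hrBlockAB_of_lt Δ₁₂ Δ₃₄ hΔ₀⟩

end Literature.MathematicalPhysics.QuantumFieldTheory.ConformalBootstrap3D
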